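import Mathlib.Analysis.Calculus.ParametricIntervalIntegral
import Mathlib.Analysis.Calculus.Gradient.Basic
import Mathlib.Analysis.InnerProductSpace.Calculus
import Mathlib.MeasureTheory.Integral.IntervalIntegral.FundThmCalculus
import Literature.Analysis.FluidPDE.KelvinCirculationProofs
import Literature.Analysis.FluidPDE.LoopCirculation
import HarnessLib

/-!
# Route `TautLoopKelvin`, crux `TautLoopLaw` (stmt-NavierStokesRegularity-15249),
  line `Sketch-ideas-r1k1` (Dini–Saks architecture) — stub `stub_tautLoopViscousKelvin`

**Kelvin's theorem with viscosity for material loops** (Majda–Bertozzi, *Vorticity and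
Incompressible Flow* (CUP 2002), §1.6, eq. (1.61), obtained from the transport formula for material
curves Prop. 1.10, eq. (1.58), `d/dt ∮_{C(t)} v·dℓ = ∮_{C(t)} Dv/Dt · dℓ`, and the Navier–Stokes
equation `Dv/Dt = -∇p + νΔv`). Let `(u, p)` be a classical unforced Navier–Stokes solution on the
slab `[a, b] × E` (`E` a finite-dimensional real inner product space, e.g. `ℝ³`), `X` a jointly
smooth particle-trajectory map with `∂ₜX(t, y) = u(t, X(t, y))` within `[a, b]`, and `γ` a closed
`C¹` loop. Then the circulation `Γ(τ) = ∮_{X_τ ∘ γ} u(τ) · dℓ` is differentiable at every interior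
time `t ∈ (a, b)` with
`Γ'(t) = ν ∫₀¹ ⟪Δu(t)(X_t(γ s)), D(X_t)(γ s) γ'(s)⟫ ds`.

**Proof.** Exactly the inviscid computation of `KelvinCirculationProofs.lean`
(`IsClassicalEulerSolutionOn.circulation_eq_of_Icc`) with the extra `νΔu` in the material
derivative: in slice form `Γ(τ) = ∫₀¹ F(τ, s) ds`, `F = ⟪u(τ, Y), ∂ₛY⟫`, `Y = X(τ, γ s)`;
differentiation under the integral sign at an interior time
(`intervalIntegral.hasDerivAt_integral_of_dominated_loc_of_deriv_le`, dominated by the maximum of the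
continuous `∂ₜF` on a compact time-neighbourhood × `[0, 1]`) gives `Γ'(t) = ∫₀¹ ∂ₜF(t, s) ds` with
`∂ₜF = ⟪u, D(u t)(Y) ∂ₛY⟫ − D(p t)(Y) ∂ₛY + ν ⟪Δ(u t)(Y), ∂ₛY⟫` (chain rule along the trajectory,
`d/dt u(t, X(t,y)) = ∂ₜu + (u·∇)u = νΔu − ∇p`, and `d/dt D(X t)(y) w = D(u t)(Y) (D(X t)(y) w)`,
`kelvin_hasDerivAt_fderiv_flow`); the first two terms are `d/ds [½‖u(t, Y)‖² − p(t, Y)]` and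
integrate to zero around the closed loop (`kelvin_integral_deriv_integrand_eq_zero`).
-/

noncomputable section

open MeasureTheory Set Function Filter intervalIntegral Literature.Analysis.FluidPDE
open _root_.Topology
open scoped ContDiff InnerProductSpace RealInnerProductSpace Laplacian

namespace Summit.NavierStokesRegularity.NavierStokesRegularity.Theorems

set_option linter.dupNamespace false

/-! ## Differentiation of a parametric interval integral at an interior time -/

/-- **Differentiation under the integral sign at an interior time.** Let `F, F' : ℝ × ℝ → ℝ` be
continuous on `[a, b] × ℝ` with `∂_τ F(τ, s) = F'(τ, s)` for `τ ∈ (a, b)` and all `s`. Then for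
`t ∈ (a, b)`, `d/dτ ∫₀¹ F(τ, s) ds |_{τ = t} = ∫₀¹ F'(t, s) ds`
(`intervalIntegral.hasDerivAt_integral_of_dominated_loc_of_deriv_le` with a constant bound, the
maximum of the continuous `‖F'‖` on a compact time-neighbourhood × `[0, 1]`). [folklore] -/
theorem tautLoopKelvin_hasDerivAt_parametric {F F' : ℝ × ℝ → ℝ} {a b : ℝ}
    (hF : ContinuousOn F (Icc a b ×ˢ univ)) (hF' : ContinuousOn F' (Icc a b ×ˢ univ))
    (hderiv : ∀ t ∈ Ioo a b, ∀ s, HasDerivAt (fun τ => F (τ, s)) (F' (t, s)) t) {t : ℝ}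
    (ht : t ∈ Ioo a b) :
    HasDerivAt (fun τ => ∫ s in (0 : ℝ)..1, F (τ, s)) (∫ s in (0 : ℝ)..1, F' (t, s)) t := by
  -- slices of jointly continuous functions are continuous
  have hsl : ∀ {G : ℝ × ℝ → ℝ}, ContinuousOn G (Icc a b ×ˢ univ) →
      ∀ t ∈ Icc a b, Continuous fun s => G (t, s) := by
    intro G hG t ht
    exact hG.comp_continuous (continuous_const.prodMk continuous_id) fun s => ⟨ht, mem_univ s⟩
  obtain ⟨ε, hε, hεsub⟩ :=
    Metric.nhds_basis_closedBall.mem_iff.1 (Ioo_mem_nhds ht.1 ht.2)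
  have hK : IsCompact (Metric.closedBall t ε) := isCompact_closedBall t ε
  have hKS : Metric.closedBall t ε ⊆ Icc a b := hεsub.trans Ioo_subset_Icc_self
  obtain ⟨C, hC⟩ := (hK.prod (isCompact_Icc (a := (0 : ℝ)) (b := 1))).exists_bound_of_continuousOn
    (hF'.mono (prod_mono hKS (subset_univ _)))
  have key := intervalIntegral.hasDerivAt_integral_of_dominated_loc_of_deriv_le
    (μ := volume) (a := (0 : ℝ)) (b := 1) (F := fun τ s => F (τ, s)) (F' := fun τ s => F' (τ, s))
    (x₀ := t) (bound := fun _ => C) (Metric.closedBall_mem_nhds t hε) ?_ ?_ ?_ ?_ ?_ ?_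
  · exact key.2
  · filter_upwards [Icc_mem_nhds ht.1 ht.2] with x hx using (hsl hF x hx).aestronglyMeasurable
  · exact (hsl hF t (Ioo_subset_Icc_self ht)).intervalIntegrable 0 1
  · exact (hsl hF' t (Ioo_subset_Icc_self ht)).aestronglyMeasurable
  · refine ae_of_all _ fun s hs x hx => hC (x, s) ⟨hx, ?_⟩
    rw [uIoc_of_le (zero_le_one : (0 : ℝ) ≤ 1)] at hs
    exact Ioc_subset_Icc_self hs
  · exact intervalIntegrable_const
  · exact ae_of_all _ fun s _ x hx => hderiv x (hεsub hx) s

/-! ## The material derivative along particle trajectories (viscous case) -/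

section Kelvin

variable {E : Type*} [NormedAddCommGroup E] [InnerProductSpace ℝ E] [FiniteDimensional ℝ E]
variable {S : Set ℝ} {ν : ℝ} {u : ℝ → E → E} {p : ℝ → E → ℝ} {X : ℝ → E → E}

/-- **The Navier–Stokes equation in joint-derivative form at an interior time.** For a classical
unforced Navier–Stokes solution on `S` and `t` in the interior of `S`,
`D(uncurry u)(t, z)(1, u(t, z)) = ∂ₜu(t, z) + (u·∇)u(t, z) = νΔu(t, z) − ∇p(t, z)`
(Majda–Bertozzi, eq. (1.13) with the Navier–Stokes equation (1.1); the one-sided time derivative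
within `S` is the two-sided one there). [folklore] -/
theorem tautLoopKelvin_fderiv_uncurry_apply_one_velocity
    (h : IsClassicalNSSolutionOn S ν 0 u p) {t : ℝ} (ht : S ∈ 𝓝 t) (z : E) :
    fderiv ℝ (uncurry u) (t, z) (1, u t z) = ν • (Δ (u t)) z - gradient (p t) z := by
  have htS : t ∈ interior S := mem_interior_iff_mem_nhds.2 ht
  have hu : IsSmoothSpaceTimeOn (interior S) u := h.smooth_velocity.mono interior_subset
  have hm := h.momentum t (interior_subset htS) z
  rw [timeDerivWithin_eq_deriv_of_mem_nhds ht, hu.deriv_timeLine isOpen_interior htS z,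
    convect_apply, hu.fderiv_slice_apply_of_isOpen isOpen_interior htS z (u t z), ← map_add] at hm
  simpa using hm

/-- **Material derivative of the velocity along a particle trajectory (viscous case).** If
`∂ₜX(t, a) = u(t, X(t, a))` within `S`, then at an interior time `t` of `S`,
`d/dt u(t, X(t, y)) = (∂ₜu + (u·∇)u)(t, X(t, y)) = νΔu(t, X(t, y)) − ∇p(t, X(t, y))` (chain rule
along the trajectory and the Navier–Stokes equation; Majda–Bertozzi, eqs. (1.1), (1.13)). [folklore] -/
theorem tautLoopKelvin_hasDerivAt_velocity_comp_flow
    (h : IsClassicalNSSolutionOn S ν 0 u p)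
    (hXu : ∀ t ∈ S, ∀ a, HasDerivWithinAt (fun s => X s a) (u t (X t a)) S t)
    {t : ℝ} (ht : S ∈ 𝓝 t) (y : E) :
    HasDerivAt (fun τ => u τ (X τ y)) (ν • (Δ (u t)) (X t y) - gradient (p t) (X t y)) t := by
  have htS : t ∈ interior S := mem_interior_iff_mem_nhds.2 ht
  have hu : IsSmoothSpaceTimeOn (interior S) u := h.smooth_velocity.mono interior_subset
  have hc : HasDerivAt (fun τ : ℝ => (τ, X τ y)) ((1 : ℝ), u t (X t y)) t :=
    (hasDerivAt_id' t).prodMk ((hXu t (interior_subset htS) y).hasDerivAt ht)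
  have hU : HasFDerivAt (uncurry u) (fderiv ℝ (uncurry u) (t, X t y)) (t, X t y) :=
    ((hu.contDiffAt isOpen_interior htS (X t y)).differentiableAt (by simp)).hasFDerivAt
  have h2 := hU.comp_hasDerivAt t hc
  rw [tautLoopKelvin_fderiv_uncurry_apply_one_velocity h ht] at h2
  exact h2

/-- **The time derivative of the circulation integrand (viscous case)** (Majda–Bertozzi, the
computation behind (1.58) and (1.61)): at an interior time `t` of `S`, for fixed `y, w`,
`d/dt ⟪u(t, X(t, y)), D(X t)(y) w⟫
  = ⟪u(t, Y), D(u t)(Y)(D(X t)(y) w)⟫ − D(p t)(Y)(D(X t)(y) w) + ν ⟪Δu(t)(Y), D(X t)(y) w⟫`,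
`Y = X(t, y)` (product rule with `tautLoopKelvin_hasDerivAt_velocity_comp_flow` and
`kelvin_hasDerivAt_fderiv_flow`, `⟪−∇p, b⟫ = −Dp b`). [folklore] -/
theorem tautLoopKelvin_hasDerivAt_circulation_integrand
    (h : IsClassicalNSSolutionOn S ν 0 u p) (hX : IsSmoothSpaceTimeOn S X)
    (hXu : ∀ t ∈ S, ∀ a, HasDerivWithinAt (fun s => X s a) (u t (X t a)) S t)
    {t : ℝ} (ht : S ∈ 𝓝 t) (y w : E) :
    HasDerivAt (fun τ => ⟪u τ (X τ y), fderiv ℝ (X τ) y w⟫)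
      (⟪u t (X t y), fderiv ℝ (u t) (X t y) (fderiv ℝ (X t) y w)⟫
        - fderiv ℝ (p t) (X t y) (fderiv ℝ (X t) y w)
        + ν * ⟪(Δ (u t)) (X t y), fderiv ℝ (X t) y w⟫) t := by
  have hG := tautLoopKelvin_hasDerivAt_velocity_comp_flow h hXu ht y
  have hB := kelvin_hasDerivAt_fderiv_flow h.smooth_velocity hX hXu ht y w
  refine (hG.inner ℝ hB).congr_deriv ?_
  rw [inner_sub_left, real_inner_smul_left, inner_gradient_left]
  ring

/-- **Kelvin's theorem with viscosity on a compact slab** `[a, b]`, `a < b`, in a general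
finite-dimensional inner product space: for a classical unforced Navier–Stokes solution on
`[a, b] × E`, a jointly smooth particle-trajectory map `X` with `∂ₜX = u(t, X)` within `[a, b]`, and a
`C¹` loop `γ` (`γ 0 = γ 1`), the circulation `τ ↦ ∮_{X(τ, γ)} u(τ) · dℓ` has derivative
`ν ∫₀¹ ⟪Δu(t)(X(t, γ s)), D(X t)(γ s) γ'(s)⟫ ds` at every interior time `t ∈ (a, b)`
(Majda–Bertozzi, §1.6, eq. (1.61) via Prop. 1.10, eq. (1.58)). [folklore] -/
theorem tautLoopKelvin_hasDerivAt_circulation {a b : ℝ} (hab : a < b)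
    (h : IsClassicalNSSolutionOn (Icc a b) ν 0 u p) (hX : IsSmoothSpaceTimeOn (Icc a b) X)
    (hXu : ∀ t ∈ Icc a b, ∀ y, HasDerivWithinAt (fun s => X s y) (u t (X t y)) (Icc a b) t)
    {γ : ℝ → E} (hγ : ContDiff ℝ 1 γ) (hloop : γ 0 = γ 1) {t : ℝ} (ht : t ∈ Ioo a b) :
    HasDerivAt (fun τ => circulation (u τ) (X τ ∘ γ))
      (ν * ∫ s in (0 : ℝ)..1, ⟪(Δ (u t)) (X t (γ s)), fderiv ℝ (X t) (γ s) (deriv γ s)⟫) t := by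
  have hSU : UniqueDiffOn ℝ (Icc a b) := uniqueDiffOn_Icc hab
  have ht' : t ∈ Icc a b := Ioo_subset_Icc_self ht
  have hγc : Continuous γ := hγ.continuous
  have hγ'c : Continuous (deriv γ) := hγ.continuous_deriv le_rfl
  -- the circulation in slice form, near `t`
  have hcirc : ∀ τ ∈ Icc a b, circulation (u τ) (X τ ∘ γ) =
      ∫ s in (0 : ℝ)..1, ⟪u τ (X τ (γ s)), fderiv ℝ (X τ) (γ s) (deriv γ s)⟫ := by
    intro τ hτ
    unfold circulation
    refine intervalIntegral.integral_congr fun s _ => ?_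
    simp only [Function.comp_apply]
    rw [fderiv_comp_deriv s ((hX.contDiff_slice hτ).differentiable (by simp) _)
      (hγ.differentiable one_ne_zero s)]
  have hev : (fun τ => circulation (u τ) (X τ ∘ γ)) =ᶠ[𝓝 t]
      fun τ => ∫ s in (0 : ℝ)..1, ⟪u τ (X τ (γ s)), fderiv ℝ (X τ) (γ s) (deriv γ s)⟫ := by
    filter_upwards [Icc_mem_nhds ht.1 ht.2] with τ hτ using hcirc τ hτ
  -- joint continuity of the building blocks on `[a, b] × ℝ`
  have hmaps : MapsTo (fun z : ℝ × ℝ => (z.1, γ z.2)) (Icc a b ×ˢ univ) (Icc a b ×ˢ univ) :=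
    fun z hz => ⟨hz.1, mem_univ _⟩
  have hY : ContinuousOn (fun z : ℝ × ℝ => X z.1 (γ z.2)) (Icc a b ×ˢ univ) :=
    hX.continuousOn.comp (continuousOn_fst.prodMk (hγc.comp continuous_snd).continuousOn) hmaps
  have hmapsY : MapsTo (fun z : ℝ × ℝ => (z.1, X z.1 (γ z.2))) (Icc a b ×ˢ univ)
      (Icc a b ×ˢ univ) := fun z hz => ⟨hz.1, mem_univ _⟩
  have hB : ContinuousOn (fun z : ℝ × ℝ => fderiv ℝ (X z.1) (γ z.2) (deriv γ z.2))
      (Icc a b ×ˢ univ) := by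
    have h1 : ContinuousOn (fun z : ℝ × ℝ => fderiv ℝ (X z.1) (γ z.2)) (Icc a b ×ˢ univ) :=
      (hX.fderiv_slice hSU).continuousOn.comp
        (continuousOn_fst.prodMk (hγc.comp continuous_snd).continuousOn) hmaps
    exact h1.clm_apply (hγ'c.comp continuous_snd).continuousOn
  have hUY : ContinuousOn (fun z : ℝ × ℝ => u z.1 (X z.1 (γ z.2))) (Icc a b ×ˢ univ) :=
    h.smooth_velocity.continuousOn.comp (continuousOn_fst.prodMk hY) hmapsY
  have hDU : ContinuousOn (fun z : ℝ × ℝ =>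
      fderiv ℝ (u z.1) (X z.1 (γ z.2)) (fderiv ℝ (X z.1) (γ z.2) (deriv γ z.2)))
      (Icc a b ×ˢ univ) := by
    have h1 : ContinuousOn (fun z : ℝ × ℝ => fderiv ℝ (u z.1) (X z.1 (γ z.2))) (Icc a b ×ˢ univ) :=
      (h.smooth_velocity.fderiv_slice hSU).continuousOn.comp (continuousOn_fst.prodMk hY) hmapsY
    exact h1.clm_apply hB
  have hDP : ContinuousOn (fun z : ℝ × ℝ =>
      fderiv ℝ (p z.1) (X z.1 (γ z.2)) (fderiv ℝ (X z.1) (γ z.2) (deriv γ z.2)))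
      (Icc a b ×ˢ univ) := by
    have h1 : ContinuousOn (fun z : ℝ × ℝ => fderiv ℝ (p z.1) (X z.1 (γ z.2))) (Icc a b ×ˢ univ) :=
      (h.smooth_pressure.fderiv_slice hSU).continuousOn.comp (continuousOn_fst.prodMk hY) hmapsY
    exact h1.clm_apply hB
  -- (the Laplacian slice field: converted with `Function.comp_def` rather than by definitional
  -- unfolding, which would unfold `Δ`)
  have hL : ContinuousOn (fun z : ℝ × ℝ => (Δ (u z.1)) (X z.1 (γ z.2))) (Icc a b ×ˢ univ) := by
    have h0 := (h.smooth_velocity.laplacian hSU).continuousOn.comp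
      (continuousOn_fst.prodMk hY) hmapsY
    simpa only [Function.comp_def, Function.uncurry_apply_pair] using h0
  have hF' : ContinuousOn (fun z : ℝ × ℝ =>
      ⟪u z.1 (X z.1 (γ z.2)), fderiv ℝ (u z.1) (X z.1 (γ z.2)) (fderiv ℝ (X z.1) (γ z.2) (deriv γ z.2))⟫
        - fderiv ℝ (p z.1) (X z.1 (γ z.2)) (fderiv ℝ (X z.1) (γ z.2) (deriv γ z.2))
        + ν * ⟪(Δ (u z.1)) (X z.1 (γ z.2)), fderiv ℝ (X z.1) (γ z.2) (deriv γ z.2)⟫)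
      (Icc a b ×ˢ univ) :=
    ((hUY.inner hDU).sub hDP).add (continuousOn_const.mul (hL.inner hB))
  -- differentiation under the integral sign
  have hd : HasDerivAt
      (fun τ => ∫ s in (0 : ℝ)..1, ⟪u τ (X τ (γ s)), fderiv ℝ (X τ) (γ s) (deriv γ s)⟫)
      (∫ s in (0 : ℝ)..1,
        (⟪u t (X t (γ s)), fderiv ℝ (u t) (X t (γ s)) (fderiv ℝ (X t) (γ s) (deriv γ s))⟫
          - fderiv ℝ (p t) (X t (γ s)) (fderiv ℝ (X t) (γ s) (deriv γ s))
          + ν * ⟪(Δ (u t)) (X t (γ s)), fderiv ℝ (X t) (γ s) (deriv γ s)⟫)) t :=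
    tautLoopKelvin_hasDerivAt_parametric (hUY.inner hB) hF'
      (fun τ hτ s => tautLoopKelvin_hasDerivAt_circulation_integrand h hX hXu
        (Icc_mem_nhds hτ.1 hτ.2) (γ s) (deriv γ s)) ht
  -- slices at time `t` are continuous, hence interval integrable
  have hslice : ∀ {G : ℝ × ℝ → ℝ}, ContinuousOn G (Icc a b ×ˢ univ) →
      Continuous fun s => G (t, s) := fun hG =>
    hG.comp_continuous (continuous_const.prodMk continuous_id) fun s => ⟨ht', mem_univ s⟩
  have hI1 : IntervalIntegrable (fun s =>
      ⟪u t (X t (γ s)), fderiv ℝ (u t) (X t (γ s)) (fderiv ℝ (X t) (γ s) (deriv γ s))⟫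
        - fderiv ℝ (p t) (X t (γ s)) (fderiv ℝ (X t) (γ s) (deriv γ s))) volume 0 1 :=
    (hslice ((hUY.inner hDU).sub hDP)).intervalIntegrable 0 1
  have hI2 : IntervalIntegrable (fun s =>
      ν * ⟪(Δ (u t)) (X t (γ s)), fderiv ℝ (X t) (γ s) (deriv γ s)⟫) volume 0 1 :=
    (hslice (continuousOn_const.mul (hL.inner hB))).intervalIntegrable 0 1
  rw [intervalIntegral.integral_add hI1 hI2,
    kelvin_integral_deriv_integrand_eq_zero h.smooth_velocity h.smooth_pressure hX hγ hloop ht' hI1,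
    zero_add, intervalIntegral.integral_const_mul] at hd
  exact hd.congr_of_eventuallyEq hev

end Kelvin

/-! ## The registered stub -/

/-- **Kelvin's theorem with viscosity for material loops** (stub `stub_tautLoopViscousKelvin` of
line `Sketch-ideas-r1k1`; Majda–Bertozzi 2002, §1.6 eq. (1.61) with the transport formula
Prop. 1.10 (1.58)): for a classical unforced Navier–Stokes solution on the slab `[a, b] × ℝ³`, a
jointly smooth particle-trajectory map `X` with `∂ₜX(t, y) = u(t, X(t, y))` within `[a, b]`, and a
closed `C¹` loop `γ`, the circulation `Γ(τ) = ∮_{X_τ ∘ γ} u(τ) · dℓ` is differentiable at every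
interior time `t` with `Γ'(t) = ν ∫₀¹ ⟪Δu(t)(X_t(γ σ)), D(X_t)(γ σ) γ'(σ)⟫ dσ`. [folklore] -/
theorem stub_tautLoopViscousKelvin : ∀ (ν a b : ℝ)
    (u : ℝ → EuclideanSpace ℝ (Fin 3) → EuclideanSpace ℝ (Fin 3))
    (p : ℝ → EuclideanSpace ℝ (Fin 3) → ℝ)
    (X : ℝ → EuclideanSpace ℝ (Fin 3) → EuclideanSpace ℝ (Fin 3))
    (γ : ℝ → EuclideanSpace ℝ (Fin 3)), a < b →
    Literature.Analysis.FluidPDE.IsClassicalNSSolutionOn (Set.Icc a b) ν 0 u p →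
    Literature.Analysis.FluidPDE.IsSmoothSpaceTimeOn (Set.Icc a b) X →
    (∀ t ∈ Set.Icc a b, ∀ y, HasDerivWithinAt (fun s => X s y) (u t (X t y)) (Set.Icc a b) t) →
    Literature.Analysis.FluidPDE.IsC1Loop γ →
    ∀ t ∈ Set.Ioo a b,
      HasDerivAt (fun τ => Literature.Analysis.FluidPDE.circulation (u τ) (X τ ∘ γ))
        (ν * ∫ σ in (0:ℝ)..1, inner ℝ (Laplacian.laplacian (u t) (X t (γ σ)))
          (fderiv ℝ (X t) (γ σ) (deriv γ σ))) t := by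
  intro ν a b u p X γ hab h hX hXu hγ t ht
  exact tautLoopKelvin_hasDerivAt_circulation hab h hX hXu hγ.contDiff hγ.apply_zero_eq_apply_one ht

end Summit.NavierStokesRegularity.NavierStokesRegularity.Theorems

end
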